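import Mathlib
import HarnessLib
import Literature.NumberTheory.Transcendental.KZCalculus
import Literature.NumberTheory.Transcendental.KZSemiCanonicalReductionProofs
import Literature.NumberTheory.Transcendental.KZLogCalculusProofs
import Literature.NumberTheory.Transcendental.SemialgebraicMapsProofs
import Summits.KontsevichZagierPeriods.KontsevichZagierPeriods.Theorems.LinRedNormalFormArrangementNormalFormStubIntegrateOutMoves

/-!
# Stub `stub_rebaseOne` (crux `ArrangementNormalForm`, line `janus-bands`) — part `Tools`

Dictionary and generic tools for `stub_rebaseOne` (skeleton v4 of crux `ArrangementNormalForm`,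
line `janus-bands`): one base coordinate `y = z 0`, one fibre coordinate `t = z 1`, affine ATOMS
`q = (α, β)` with value `ev q y = α y + β`, base cells `baseSet M = {y | ∀ j, 0 < ev (M j) y}`,
BANDS `band I u v = {y ∈ I, u y < t < v y}`, and the integrand
`integ T a = q (y-μ)^{n₁}/(y-μ)^{n₂} · [1 | 1/(t - ev c y)]` (`T = (q, μ, n₁, n₂)`, letter `a`).
Semialgebraicity and measurability of these, null lines in the plane, band representations
(`IsBandRep`), the literal class `GG 0 2 1` of the skeleton (`GGlit`) and the PACKAGING lemma:
a band representation with constant letter and bounds constant-or-`y` lies in `GG 0 2 1`.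

References: M. Kontsevich, D. Zagier, *Periods* (2001), §1.2.
-/

noncomputable section

open Set MeasureTheory
open Literature.NumberTheory.Transcendental
open Literature.ModelTheory.ExponentialFields

namespace Summit.KontsevichZagierPeriods.ArrangementNormalForm.JanusBands

namespace RebaseOne

/-! ### Atoms, base cells, bands, integrands -/

/-- Affine atom `(α, β)` with value `α y + β`. -/
abbrev Aff := ℚ × ℚ

/-- Value of an atom at `y`. -/
def ev (q : Aff) (y : ℝ) : ℝ := (q.1 : ℝ) * y + (q.2 : ℝ)

/-- `ev` of a difference. -/
@[simp] theorem ev_sub (p q : Aff) (y : ℝ) : ev (p - q) y = ev p y - ev q y := by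
  simp only [ev, Prod.fst_sub, Prod.snd_sub, Rat.cast_sub]; ring

/-- `ev` of a negative. -/
@[simp] theorem ev_neg (q : Aff) (y : ℝ) : ev (-q) y = -ev q y := by
  simp only [ev, Prod.fst_neg, Prod.snd_neg, Rat.cast_neg]; ring

/-- `ev` of a sum. -/
@[simp] theorem ev_add (p q : Aff) (y : ℝ) : ev (p + q) y = ev p y + ev q y := by
  simp only [ev, Prod.fst_add, Prod.snd_add, Rat.cast_add]; ring

/-- `|ev q y| ≤ |q.1| |y| + |q.2|`. -/
theorem abs_ev_le (q : Aff) (y : ℝ) : |ev q y| ≤ |(q.1 : ℝ)| * |y| + |(q.2 : ℝ)| := by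
  unfold ev
  calc |(q.1 : ℝ) * y + q.2| ≤ |(q.1 : ℝ) * y| + |(q.2 : ℝ)| := abs_add_le _ _
    _ = |(q.1 : ℝ)| * |y| + |(q.2 : ℝ)| := by rw [abs_mul]

/-- `ev` of the zero atom. -/
@[simp] theorem ev_zero (y : ℝ) : ev 0 y = 0 := by
  simp [ev]

/-- `ev` of a literal pair. -/
theorem ev_mk (a b : ℚ) (y : ℝ) : ev (a, b) y = (a : ℝ) * y + (b : ℝ) := rfl

/-- Base cell cut out by finitely many strict affine inequalities. -/
def baseSet {m : ℕ} (M : Fin m → Aff) : Set ℝ := {y | ∀ j, 0 < ev (M j) y}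

/-- Adding a row to a base cell. -/
theorem mem_baseSet_cons {m : ℕ} (q : Aff) (M : Fin m → Aff) (y : ℝ) :
    y ∈ baseSet (Fin.cons q M : Fin (m + 1) → Aff) ↔ 0 < ev q y ∧ y ∈ baseSet M := by
  simp only [baseSet, mem_setOf_eq, Fin.forall_fin_succ, Fin.cons_zero, Fin.cons_succ]

/-- The band over `I` between `u` and `v`. -/
def band (I : Set ℝ) (u v : ℝ → ℝ) : Set (Fin 2 → ℝ) :=
  {z | z 0 ∈ I ∧ u (z 0) < z 1 ∧ z 1 < v (z 0)}

/-- Integrand data `(q, μ, n₁, n₂)`. -/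
abbrev IData := ℚ × ℚ × ℕ × ℕ

/-- The base factor `q (y-μ)^{n₁} / (y-μ)^{n₂}`. -/
def gfun (T : IData) (y : ℝ) : ℝ := (T.1 : ℝ) * (y - T.2.1) ^ T.2.2.1 / (y - T.2.1) ^ T.2.2.2

/-- The integrand: base factor times the letter factor. -/
def integ (T : IData) (a : Option Aff) (z : Fin 2 → ℝ) : ℝ :=
  gfun T (z 0) * a.elim 1 (fun c => 1 / (z 1 - ev c (z 0)))

/-! ### Semialgebraicity and measurability -/

/-- `{z | 0 < ev q (z 0)}` is semialgebraic. -/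
theorem isSemialgebraic_ev_pos (q : Aff) : IsSemialgebraic ℚ {z : Fin 2 → ℝ | 0 < ev q (z 0)} := by
  convert isSemialgebraic_setOf_eval_pos (R := ℝ)
    (MvPolynomial.C q.1 * MvPolynomial.X (0 : Fin 2) + MvPolynomial.C q.2) using 2 with z
  simp [ev]

/-- Bands over base cells with affine bounds are semialgebraic. -/
theorem isSemialgebraic_band {m : ℕ} (M : Fin m → Aff) (U V : Aff) :
    IsSemialgebraic ℚ (band (baseSet M) (ev U) (ev V)) := by
  have h1 : IsSemialgebraic ℚ (⋂ j ∈ (Finset.univ : Finset (Fin m)),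
      {z : Fin 2 → ℝ | 0 < ev (M j) (z 0)}) :=
    IsSemialgebraic.biInter _ _ fun j _ => isSemialgebraic_ev_pos (M j)
  have h2 : IsSemialgebraic ℚ {z : Fin 2 → ℝ | ev U (z 0) < z 1} := by
    convert isSemialgebraic_setOf_eval_pos (R := ℝ) (MvPolynomial.X (1 : Fin 2) -
      (MvPolynomial.C U.1 * MvPolynomial.X (0 : Fin 2) + MvPolynomial.C U.2)) using 2 with z
    simp [ev, sub_pos]
  have h3 : IsSemialgebraic ℚ {z : Fin 2 → ℝ | z 1 < ev V (z 0)} := by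
    convert isSemialgebraic_setOf_eval_pos (R := ℝ)
      (MvPolynomial.C V.1 * MvPolynomial.X (0 : Fin 2) + MvPolynomial.C V.2 -
        MvPolynomial.X (1 : Fin 2)) using 2 with z
    simp [ev, sub_pos]
  convert (h1.inter h2).inter h3 using 1
  ext z
  simp [band, baseSet, mem_iInter]
  tauto

/-- The integrand is a semialgebraic function on any semialgebraic set. -/
theorem isSemialgebraicFunOn_integ {s : Set (Fin 2 → ℝ)} (hs : IsSemialgebraic ℚ s) (T : IData)
    (a : Option Aff) : IsSemialgebraicFunOn ℚ s (integ T a) := by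
  have hg : IsSemialgebraicFunOn ℚ s (fun z => gfun T (z 0)) := by
    refine (IntegrateOut.isSemialgebraicFunOn_div (isSemialgebraicFunOn_aeval hs
      (MvPolynomial.C T.1 * (MvPolynomial.X 0 - MvPolynomial.C T.2.1) ^ T.2.2.1))
      (isSemialgebraicFunOn_aeval hs ((MvPolynomial.X 0 - MvPolynomial.C T.2.1) ^ T.2.2.2))).congr
      fun z _ => ?_
    simp [gfun]
  cases a with
  | none => exact hg.congr fun z _ => by simp [integ]
  | some c =>
    have hl : IsSemialgebraicFunOn ℚ s (fun z : Fin 2 → ℝ => 1 / (z 1 - ev c (z 0))) := by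
      refine (IntegrateOut.isSemialgebraicFunOn_div (isSemialgebraicFunOn_aeval hs 1)
        (isSemialgebraicFunOn_aeval hs (MvPolynomial.X 1 -
          (MvPolynomial.C c.1 * MvPolynomial.X 0 + MvPolynomial.C c.2)))).congr fun z _ => ?_
      simp [ev]
    exact (IsSemialgebraicFunOn.mul_holds hg hl).congr fun z _ => by simp [integ]

/-- The integrand is measurable. -/
theorem measurable_integ (T : IData) (a : Option Aff) : Measurable (integ T a) := by
  unfold integ gfun ev
  cases a with
  | none => simp only [Option.elim_none]; fun_prop
  | some c => simp only [Option.elim_some]; fun_prop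

/-- Bands over base cells are measurable. -/
theorem measurableSet_band {m : ℕ} (M : Fin m → Aff) (U V : Aff) :
    MeasurableSet (band (baseSet M) (ev U) (ev V)) :=
  IsSemialgebraic.measurableSet_holds (isSemialgebraic_band M U V)

/-! ### Null lines -/

/-- Volumes in the plane `Fin 2 → ℝ` through product coordinates. -/
theorem volume_setOf_fin2 (A : Set (ℝ × ℝ)) :
    volume {z : Fin 2 → ℝ | (z 0, z 1) ∈ A} = (volume : Measure ℝ).prod volume A := by
  rw [← Measure.volume_eq_prod]
  exact (volume_preserving_piFinTwo (fun _ => ℝ)).measure_preimage_equiv A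

/-- The graph of a measurable function is null. -/
theorem volume_graph (f : ℝ → ℝ) (hf : Measurable f) :
    volume {z : Fin 2 → ℝ | z 1 = f (z 0)} = 0 := by
  have hA : MeasurableSet {p : ℝ × ℝ | p.2 = f p.1} :=
    measurableSet_eq_fun measurable_snd (hf.comp measurable_fst)
  have := volume_setOf_fin2 {p : ℝ × ℝ | p.2 = f p.1}
  simp only [mem_setOf_eq] at this
  rw [this, Measure.prod_apply hA]
  refine (lintegral_congr fun x => ?_).trans lintegral_zero
  simp [Set.preimage, setOf_eq_eq_singleton]

/-- Vertical lines are null. -/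
theorem volume_vline (p : ℝ) : volume {z : Fin 2 → ℝ | z 0 = p} = 0 := by
  have := volume_setOf_fin2 ({p} ×ˢ (univ : Set ℝ))
  simp only [mem_prod, mem_singleton_iff, mem_univ, and_true] at this
  rw [this, Measure.prod_prod, Real.volume_singleton, zero_mul]

/-- The graph of an atom is null. -/
theorem volume_graph_ev (q : Aff) : volume {z : Fin 2 → ℝ | z 1 = ev q (z 0)} = 0 :=
  volume_graph (ev q) (by unfold ev; fun_prop)

/-- The zero set of a nonzero atom (in the plane) is null. -/
theorem volume_ev_eq_zero (q : Aff) (hq : q ≠ 0) : volume {z : Fin 2 → ℝ | ev q (z 0) = 0} = 0 := by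
  by_cases h1 : q.1 = 0
  · have h2 : q.2 ≠ 0 := fun h2 => hq (Prod.ext h1 h2)
    convert measure_empty (μ := (volume : Measure (Fin 2 → ℝ))) using 2
    ext z
    simp [ev, h1, h2]
  · convert volume_vline (-(q.2 : ℝ) / q.1) using 2
    ext z
    simp only [mem_setOf_eq, ev]
    constructor
    · intro h; field_simp; linarith
    · intro h; rw [h]; field_simp; ring

/-- Integrability on a null set. -/
theorem integrableOn_of_null {f : (Fin 2 → ℝ) → ℝ} {N : Set (Fin 2 → ℝ)} (hN : volume N = 0) :
    IntegrableOn f N := by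
  rw [IntegrableOn, Measure.restrict_eq_zero.2 hN]
  exact integrable_zero_measure

/-! ### Bounds -/

/-- Coordinates of a bounded planar set are bounded. -/
theorem exists_abs_le {D : Set (Fin 2 → ℝ)} (hD : Bornology.IsBounded D) :
    ∃ R : ℝ, 0 ≤ R ∧ ∀ z ∈ D, |z 0| ≤ R ∧ |z 1| ≤ R := by
  obtain ⟨R, hR0, hR⟩ := hD.exists_pos_norm_le
  have key : ∀ z ∈ D, ∀ i, |z i| ≤ R := fun z hz i => by
    have h := norm_le_pi_norm z i
    rw [Real.norm_eq_abs] at h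
    exact h.trans (hR z hz)
  exact ⟨R, hR0.le, fun z hz => ⟨key z hz 0, key z hz 1⟩⟩

/-- A planar set with bounded coordinates is bounded. -/
theorem isBounded_of_abs_le {D : Set (Fin 2 → ℝ)} (R : ℝ)
    (h : ∀ z ∈ D, |z 0| ≤ R ∧ |z 1| ≤ R) : Bornology.IsBounded D := by
  rw [isBounded_iff_forall_norm_le]
  refine ⟨max R 0, fun z hz => ?_⟩
  rw [pi_norm_le_iff_of_nonneg (le_max_right _ _)]
  intro i
  fin_cases i
  · exact (Real.norm_eq_abs _).le.trans ((h z hz).1.trans (le_max_left _ _))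
  · exact (Real.norm_eq_abs _).le.trans ((h z hz).2.trans (le_max_left _ _))

/-! ### Band representations and the target class -/

/-- `r` is the band representation with rows `M`, bounds `U < t < V`, integrand data `T` and
letter `a`. -/
structure IsBandRep (r : KZ.IntegralRep 2) {m : ℕ} (M : Fin m → Aff) (U V : Aff) (T : IData)
    (a : Option Aff) : Prop where
  /-- the domain is the band -/
  dom : r.domain = band (baseSet M) (ev U) (ev V)
  /-- the integrand is `integ T a` on the domain -/
  int : EqOn r.integrand (integ T a) r.domain
  /-- the domain is bounded -/
  bdd : Bornology.IsBounded r.domain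
  /-- admissible exponents -/
  adm : T.2.2.1 = 0 ∨ T.2.2.2 = 0

/-- Restricting a band representation to a sub-band. -/
theorem IsBandRep.restrict {r : KZ.IntegralRep 2} {m m' : ℕ} {M : Fin m → Aff} {U V : Aff}
    {T : IData} {a : Option Aff} (h : IsBandRep r M U V T a) (M' : Fin m' → Aff) (U' V' : Aff)
    (hsub : band (baseSet M') (ev U') (ev V') ⊆ r.domain) :
    IsBandRep (r.restrict _ (isSemialgebraic_band M' U' V') hsub) M' U' V' T a :=
  ⟨rfl, fun _ hz => h.int (hsub hz), h.bdd.subset hsub, h.adm⟩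

/-- The literal class `GG b σ k` of the skeleton. -/
def GGlit (b σ k : ℕ) : Set KZ.FormalRep := {w : KZ.FormalRep | ∃ (m m' n₁ n₂ : ℕ) (s : KZ.IntegralRep (b + 1 + k)) (M : Fin m' → (Fin (b + 1) → ℚ) × ℚ) (L : Fin m → (Fin b → ℚ) × ℚ) (e : Fin m → ℕ) (p : MvPolynomial (Fin b) ℚ) (ℓ₁ ℓ₂ : (Fin b → ℚ) × ℚ) (a : Fin k → Option ((Fin (b + 1) → ℚ) × ℚ)) (lo hi : Fin k → Fin k ⊕ ((Fin (b + 1) → ℚ) × ℚ)), (n₁ = 0 ∨ n₂ = 0) ∧ (σ = 2 → (∀ i c, a i = some c → c.1 (Fin.last b) = 0) ∧ (∀ i c, (lo i = Sum.inr c ∨ hi i = Sum.inr c) → (c.1 (Fin.last b) = 0 ∨ c = (Pi.single (Fin.last b) 1, 0)))) ∧ Bornology.IsBounded s.domain ∧ s.domain = {z | (∀ j, 0 < ∑ i, ((M j).1 i : ℝ) * z (Fin.castAdd k i) + ((M j).2 : ℝ)) ∧ ∀ i, Sum.elim (fun j => z (Fin.natAdd (b + 1) j)) (fun c => ∑ i',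 (c.1 i' : ℝ) * z (Fin.castAdd k i') + (c.2 : ℝ)) (lo i) < z (Fin.natAdd (b + 1) i) ∧ z (Fin.natAdd (b + 1) i) < Sum.elim (fun j => z (Fin.natAdd (b + 1) j)) (fun c => ∑ i', (c.1 i' : ℝ) * z (Fin.castAdd k i') + (c.2 : ℝ)) (hi i)} ∧ EqOn s.integrand (fun z => MvPolynomial.aeval (fun i => z (Fin.castAdd k (Fin.castSucc i))) p / (∏ j, (∑ i, ((L j).1 i : ℝ) * z (Fin.castAdd k (Fin.castSucc i)) + ((L j).2 : ℝ)) ^ e j) * ((z (Fin.castAdd k (Fin.last b)) - (∑ i, (ℓ₁.1 i : ℝ) * z (Fin.castAdd k (Fin.castSucc i)) + (ℓ₁.2 : ℝ))) ^ n₁ / (z (Fin.castAdd k (Fin.last b)) - (∑ i, (ℓ₂.1 i : ℝ) * z (Fin.castAdd k (Fin.castSucc i)) + (ℓ₂.2 : ℝ))) ^ n₂) * ∏ i, (a i).elim 1 (fun c => 1 / (z (Fin.natAdd (b + 1) i) - (∑ i', (c.1 i' : ℝ) * z (Fin.castAdd k i') + (c.2 : ℝ))))) s.domain ∧ w = KZ.of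 s}

/-- `GOOD` formal combinations: congruent to the subgroup generated by `GG 0 2 1`. -/
def Good (x : KZ.FormalRep) : Prop :=
  ∃ c ∈ AddSubgroup.closure (GGlit 0 2 1), x - c ∈ KZ.relations

/-- Elements of `GG 0 2 1` are good. -/
theorem good_of_mem {x : KZ.FormalRep} (h : x ∈ GGlit 0 2 1) : Good x :=
  ⟨x, AddSubgroup.subset_closure h, by simp⟩

/-- Relations are good. -/
theorem good_of_mem_relations {x : KZ.FormalRep} (h : x ∈ KZ.relations) : Good x :=
  ⟨0, zero_mem _, by simpa using h⟩

/-- Goodness passes along relations. -/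
theorem good_of_sub_mem {x y : KZ.FormalRep} (h : x - y ∈ KZ.relations) (hy : Good y) : Good x := by
  obtain ⟨c, hc, hyc⟩ := hy
  refine ⟨c, hc, ?_⟩
  have := add_mem h hyc
  rwa [sub_add_sub_cancel] at this

/-- Sums of good elements are good. -/
theorem Good.add {x y : KZ.FormalRep} (hx : Good x) (hy : Good y) : Good (x + y) := by
  obtain ⟨c, hc, hxc⟩ := hx
  obtain ⟨d, hd, hyd⟩ := hy
  refine ⟨c + d, add_mem hc hd, ?_⟩
  have := add_mem hxc hyd
  rwa [show x - c + (y - d) = x + y - (c + d) by abel] at this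

/-- Differences of good elements are good. -/
theorem Good.sub {x y : KZ.FormalRep} (hx : Good x) (hy : Good y) : Good (x - y) := by
  obtain ⟨c, hc, hxc⟩ := hx
  obtain ⟨d, hd, hyd⟩ := hy
  refine ⟨c - d, sub_mem hc hd, ?_⟩
  have := sub_mem hxc hyd
  rwa [show x - c - (y - d) = x - y - (c - d) by abel] at this

/-- Finite sums of good elements are good. -/
theorem good_sum {ι : Type*} (s : Finset ι) (f : ι → KZ.FormalRep) (h : ∀ i ∈ s, Good (f i)) :
    Good (∑ i ∈ s, f i) := by
  classical
  induction s using Finset.induction_on with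
  | empty => simpa using good_of_mem_relations (zero_mem _)
  | insert a s ha ih =>
    rw [Finset.sum_insert ha]
    exact (h a (Finset.mem_insert_self a s)).add (ih fun i hi => h i (Finset.mem_insert_of_mem hi))

/-- Base coordinate of the literal text. -/
theorem castAdd_last : (Fin.castAdd 1 (Fin.last 0) : Fin (0 + 1 + 1)) = (0 : Fin 2) := rfl

/-- Base coordinate of the literal text (inside sums). -/
theorem castAdd_zero : (Fin.castAdd 1 (0 : Fin (0 + 1)) : Fin (0 + 1 + 1)) = (0 : Fin 2) := rfl

/-- Fibre coordinate of the literal text. -/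
theorem natAdd_zero : (Fin.natAdd (0 + 1) (0 : Fin 1) : Fin (0 + 1 + 1)) = (1 : Fin 2) := rfl

/-- **Packaging.** A band representation with constant letter and bounds constant-or-`y` is an
element of `GG 0 2 1`. -/
theorem mem_GGlit {r : KZ.IntegralRep 2} {m : ℕ} {M : Fin m → Aff} {U V : Aff} {T : IData}
    {a : Option Aff} (h : IsBandRep r M U V T a) (ha : ∀ c, a = some c → c.1 = 0)
    (hU : U.1 = 0 ∨ U = (1, 0)) (hV : V.1 = 0 ∨ V = (1, 0)) : KZ.of r ∈ GGlit 0 2 1 := by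
  have hsingle : (fun _ : Fin (0 + 1) => (1 : ℚ)) = Pi.single (Fin.last 0) 1 := by
    funext i
    have hi : i = Fin.last 0 := Fin.ext (by have := i.isLt; simp only [Fin.val_last]; omega)
    rw [hi, Pi.single_eq_same]
  have hbd : ∀ W : Aff, (W.1 = 0 ∨ W = (1, 0)) → ((fun _ : Fin (0 + 1) => W.1, W.2) : (Fin (0 + 1) → ℚ) × ℚ).1 (Fin.last 0) = 0 ∨
      ((fun _ : Fin (0 + 1) => W.1, W.2) : (Fin (0 + 1) → ℚ) × ℚ) = (Pi.single (Fin.last 0) 1, 0) := by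
    rintro W (hW | rfl)
    · exact Or.inl hW
    · exact Or.inr (Prod.ext hsingle rfl)
  refine ⟨0, m, T.2.2.1, T.2.2.2, r, fun j => (fun _ => (M j).1, (M j).2), Fin.elim0, Fin.elim0,
    MvPolynomial.C T.1, (Fin.elim0, T.2.1), (Fin.elim0, T.2.1),
    fun _ => a.map (fun c => (fun _ => c.1, c.2)),
    fun _ => Sum.inr (fun _ => U.1, U.2), fun _ => Sum.inr (fun _ => V.1, V.2),
    h.adm, fun _ => ⟨fun i c' hc' => ?_, fun i c' hc' => ?_⟩, h.bdd, ?_, fun z hz => ?_, rfl⟩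
  · cases a with
    | none => simp at hc'
    | some c =>
      simp only [Option.map_some, Option.some.injEq] at hc'
      rw [← hc']
      exact ha c rfl
  · rcases hc' with hc' | hc' <;> simp only [Sum.inr.injEq] at hc' <;> subst hc'
    · exact hbd U hU
    · exact hbd V hV
  · rw [h.dom]
    ext z
    simp only [band, baseSet, mem_setOf_eq, Fin.sum_univ_succ, Finset.univ_eq_empty,
      Finset.sum_empty, add_zero, castAdd_zero, Fin.forall_fin_one, Sum.elim_inr, natAdd_zero, ev]
  · rw [h.int hz]
    cases a with
    | none =>
      simp only [integ, gfun, Option.elim_none, Option.map_none, MvPolynomial.aeval_C, eq_ratCast,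
        Finset.univ_eq_empty, Finset.prod_empty, Finset.sum_empty, zero_add, div_one,
        Fin.prod_univ_one, castAdd_last, mul_one]
      ring
    | some c =>
      simp only [integ, gfun, Option.elim_some, Option.map_some, MvPolynomial.aeval_C, eq_ratCast,
        Finset.univ_eq_empty, Finset.prod_empty, Finset.sum_empty, zero_add, div_one,
        Fin.prod_univ_one, castAdd_last, Fin.sum_univ_succ, add_zero, castAdd_zero, natAdd_zero, ev]
      ring

end RebaseOne

/-- Registered support goal of this file: graphs of measurable functions are null in the plane. -/
theorem rebaseOne_volume_graph (f : ℝ → ℝ) (hf : Measurable f) : volume {z : Fin 2 → ℝ | z 1 = f (z 0)} = 0 :=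
  RebaseOne.volume_graph f hf

end Summit.KontsevichZagierPeriods.ArrangementNormalForm.JanusBands
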